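/-
Copyright (c) 2026. All rights reserved.
Released under Apache 2.0 license as described in the file LICENSE.
Authors: abc-iut cell, prover seat abc-iut-w5-d014 (wave 5, gen 4).
-/
import Literature.IUT.LogVolume.UnitLogUnramifiedDyadic
import Literature.AnabelianGeometry.AbsoluteAnabelian.LogShellsOfUnitLog
import HarnessLib

/-!
# Unramified dyadic fields: the EXACT shape `log₂(𝒪_K^×) = 2·℘(𝒪_K) + 4·𝒪_K` of the unit logarithms

Proof-only companion (theorems, no definitions, no named facts) of abc-iut-w5-d180's
`UnitLogUnramifiedDyadic.lean` (same namespace: the congruence `log₂(1 − 2w) ≡ −2w(1 + w) (mod 4𝒪)`, the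
Artin–Schreier map `℘(c) = c² + c` of the residue field is not onto, `log₂(𝒪_K^×)` is no ball for `f ≥ 2`), of
abc-iut-S1's `LocalUnitLog.lean` / `RamificationInvariants.lean` ([IUTchIV] Prop. 1.2 (i):
"`p^{a}·R ⊆ log_p(R^×) ⊆ p^{-b}·R`", `a = 2` at `p = 2`) and of abc-iut-L3-t11's `LogShellsOfUnitLog.lean`
([AbsTopIII] Def. 5.4 (iii): `log₂ : 1 + 4𝒪 ≅ 4𝒪`).  `K` is a complete, proper (= locally compact) ultrametric
normed `ℚ₂`-algebra which is a field with `absRamificationIdx 2 K = 1` (absolutely unramified: every finite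
unramified extension of `ℚ₂`), `𝒪 = {‖x‖ ≤ 1}`, `k = 𝒪/2𝒪` its residue field (`#k = 2^f`), `℘(a) = a² + a`.

* `closedBall_four_subset_logUnits`, `logUnits_subset_closedBall_two` — `4𝒪 ⊆ log₂(𝒪^×) ⊆ 2𝒪` (both radii
  of [IUTchIV] Prop. 1.2 (i) at `p = 2`, `e = 1`, i.e. `a = 2`, `−b = 1`);
* **`mem_logUnits_iff_exists_norm_sub_le`** — `y ∈ log₂(𝒪^×) ↔ ∃ x ∈ 𝒪, ‖y − 2(x + x²)‖ ≤ ‖4‖`, i.e.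
  `log₂(𝒪^×) = 2·℘(𝒪) + 4𝒪` EXACTLY (every unit `u` has an odd power `u^m = 1 − 2x`, and `m⁻¹ ≡ 1 (mod 2)`);
  residue form **`two_mul_mem_logUnits_iff_residue`**: for `y ∈ 𝒪`, `2y ∈ log₂(𝒪^×) ↔ ȳ ∈ ℘(k)`
  (`log₂(𝒪^×)/4𝒪 = 2·℘(k)` inside `2𝒪/4𝒪 ≅ k`, an index-`2` subgroup since `℘` is additive with kernel `𝔽₂`);
* `logUnits_eq_closedBall_four_of_residueDegree_eq_one` — `f = 1` ⇒ `log₂(𝒪^×) = 4𝒪` (e.g.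
  `log₂(ℤ₂^×) = 4ℤ₂`: the hypothesis `f ≥ 2` of `logUnits_ne_closedBall` is sharp);
  `closedBall_four_ssubset_logUnits` (`f ≥ 2`), `logUnits_ssubset_closedBall_two` (every `f`),
  `logUnits_ne_smul_closedBall` (`f ≥ 2`: `log₂(𝒪^×) ≠ c·𝒪` for every `c`, so the log-shell
  `ℐ = 4⁻¹·log₂(𝒪^×)` of [AbsTopIII] Def. 5.4 (iii) is NOT a fractional ideal of `𝒪`).

The unit stabiliser of `log₂(𝒪^×)` (`= 1 + 2𝒪`) is the sibling file `UnitLogUnramifiedDyadicStabilizer.lean`.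
Consumers (not imported): the cell's TEAM R «`ismDH` mover» files (abc-iut-w5-d039 p433488, abc-iut-w5-d180).
Classical local analysis (Neukirch II (5.5); Serre, *Local Fields* XIV §4); nothing here is disputed
mathematics, no IUT statement is asserted, nothing bears on which reading of [IUTchIII] is print's.

References: [cite: NeukirchANT1999, Ch. II Prop. (5.5)] · [cite: MochizukiAbsTopIII2015, Def. 5.4 (iii) p. 126] ·
[claim: Mochizuki2012, status: disputed] for the [IUTchIV] Prop. 1.2 locators only.
-/

noncomputable section

open Metric Set IsLocalRing
open scoped Pointwise

namespace Literature.IUT.LogVolume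

namespace UnramifiedDyadic

open Literature.NumberTheory.GaloisRepresentations.Ultrametric
open Literature.AnabelianGeometry.AbsoluteAnabelian (bijOn_unitLog_principalUnits)

variable {K : Type*} [NontriviallyNormedField K] [instK : NormedAlgebra ℚ_[2] K]

/-! ## 1. Norms of `4` and of inverses of odd integers -/

/-- `‖4‖ = 1/4` in a normed `ℚ₂`-algebra. [cite: NeukirchANT1999, Ch. II Prop. (5.5)] -/
theorem norm_four : ‖(4 : K)‖ = 4⁻¹ := by
  rw [show (4 : K) = 2 * 2 by norm_num, norm_mul, WildDyadic.norm_two]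
  norm_num

variable [IsUltrametricDist K]

/-- For an odd natural number `m`, `‖m⁻¹ − 1‖ ≤ ‖2‖` in `K` (`m⁻¹ ≡ 1 (mod 2ℤ₂)`).
[cite: NeukirchANT1999, Ch. II Prop. (5.5)] -/
theorem norm_inv_natCast_sub_one_le {m : ℕ} (hm : ¬ 2 ∣ m) : ‖((m : K))⁻¹ - 1‖ ≤ 2⁻¹ := by
  have hm1 : ‖(m : K)‖ = 1 := norm_natCast_eq_one_of_not_dvd 2 hm
  have hm0 : (m : K) ≠ 0 := norm_pos_iff.mp (by rw [hm1]; exact one_pos)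
  have hodd : m = 2 * (m / 2) + 1 := by omega
  have hmK : (m : K) = 2 * ((m / 2 : ℕ) : K) + 1 := by
    conv_lhs => rw [hodd]
    push_cast
    ring
  have hsub : ((m : K))⁻¹ - 1 = -(2 * ((m / 2 : ℕ) : K)) * ((m : K))⁻¹ := by
    rw [eq_comm, ← sub_eq_zero]
    have : -(2 * ((m / 2 : ℕ) : K)) = 1 - (m : K) := by rw [hmK]; ring
    rw [this, sub_mul, one_mul, mul_inv_cancel₀ hm0]
    ring
  rw [hsub, norm_mul, norm_neg, norm_mul, norm_inv, hm1, inv_one, mul_one, WildDyadic.norm_two]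
  exact mul_le_of_le_one_right (by norm_num) (IsUltrametricDist.norm_natCast_le_one K _)

variable [CompleteSpace K]

/-- `log₂(1 − 2x) ≡ −2(x + x²) (mod 4𝒪)` for `‖x‖ ≤ 1`, for the logarithmic series (abc-iut-w5-d180's
`norm_logSeries_add_le_quarter`, rewritten with `2x(1 + x) = 2(x + x²)`). [cite: NeukirchANT1999, Ch. II Prop. (5.5)] -/
theorem norm_logSeries_one_sub_two_mul_add_le {x : K} (hx : ‖x‖ ≤ 1) :
    ‖logSeries (1 - 2 * x) + 2 * (x + x ^ 2)‖ ≤ 4⁻¹ := by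
  have h := norm_logSeries_add_le_quarter hx
  rwa [show (2 : K) * x * (1 + x) = 2 * (x + x ^ 2) by ring] at h

omit [IsUltrametricDist K] [CompleteSpace K] in
/-- `1 − 2x` is a principal unit for `‖x‖ ≤ 1`. [cite: NeukirchANT1999, Ch. II Prop. (5.5)] -/
theorem isPrincipal_one_sub_two_mul {x : K} (hx : ‖x‖ ≤ 1) : IsPrincipal (1 - 2 * x) := by
  rw [isPrincipal_iff, sub_sub_cancel, norm_mul, WildDyadic.norm_two]
  exact (mul_le_of_le_one_right (by norm_num) hx).trans_lt (by norm_num)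

/-- **`log₂(1 − 2x) ≡ −2(x + x²) (mod 4𝒪)`** for `‖x‖ ≤ 1`, for abc-iut-S1's `unitLog = log₂`.
[cite: NeukirchANT1999, Ch. II Prop. (5.5)] -/
theorem norm_unitLog_one_sub_two_mul_add_le {x : K} (hx : ‖x‖ ≤ 1) :
    ‖unitLog (1 - 2 * x) + 2 * (x + x ^ 2)‖ ≤ ‖(4 : K)‖ := by
  rw [unitLog_of_isPrincipal 2 (isPrincipal_one_sub_two_mul hx), norm_four]
  exact norm_logSeries_one_sub_two_mul_add_le hx

/-! ## 2. `4𝒪 ⊆ log₂(𝒪^×) ⊆ 2𝒪` -/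

/-- **`4𝒪 ⊆ log₂(𝒪_K^×)`** (any dyadic `K`: `log₂` maps `1 + 4𝒪` onto `4𝒪`, [AbsTopIII] Def. 5.4 (iii) with
`p* = 4`, abc-iut-L3-t11's `bijOn_unitLog_principalUnits`). [cite: MochizukiAbsTopIII2015, Def. 5.4 (iii) p. 126] -/
theorem closedBall_four_subset_logUnits : closedBall (0 : K) ‖(4 : K)‖ ⊆ logUnits K := by
  intro z hz
  have hb := bijOn_unitLog_principalUnits 2 K
  have h4 : ((2 ^ (if (2 : ℕ) = 2 then 2 else 1) : ℕ) : K) = 4 := by norm_num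
  rw [h4] at hb
  obtain ⟨y, hy, rfl⟩ := hb.surjOn hz
  refine unitLog_mem_logUnits (IsPrincipal.norm_eq_one ?_)
  rw [mem_closedBall, dist_eq_norm, norm_sub_rev] at hy
  exact hy.trans_lt (by rw [norm_four]; norm_num)

/-- `4 ∈ log₂(𝒪_K^×)`. [cite: MochizukiAbsTopIII2015, Def. 5.4 (iii) p. 126] -/
theorem four_mem_logUnits : (4 : K) ∈ logUnits K :=
  closedBall_four_subset_logUnits (by rw [mem_closedBall, dist_zero_right])

variable [ProperSpace K]

omit [CompleteSpace K] in
/-- **`log₂(𝒪_K^×) ⊆ 2𝒪`** for unramified `K` (`‖log₂ u‖ ≤ 2⁻¹`, abc-iut-w5-d172's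
`norm_unitLog_le_inv_of_absRamificationIdx_eq_one`). [cite: NeukirchANT1999, Ch. II Prop. (5.5)] -/
theorem logUnits_subset_closedBall_two (he : absRamificationIdx 2 K = 1) :
    logUnits K ⊆ closedBall (0 : K) ‖(2 : K)‖ := by
  rintro _ ⟨u, -, rfl⟩
  rw [mem_closedBall, dist_zero_right, WildDyadic.norm_two]
  have h := norm_unitLog_le_inv_of_absRamificationIdx_eq_one 2 he u
  exact_mod_cast h

/-! ## 3. The Artin–Schreier description `log₂(𝒪^×) = 2·℘(𝒪) + 4𝒪` -/

/-- Membership in `log₂(𝒪^×)` is stable under adding an element of `4𝒪`.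
[cite: NeukirchANT1999, Ch. II Prop. (5.5)] -/
theorem add_mem_logUnits_of_norm_le {y t : K} (hy : y ∈ logUnits K) (ht : ‖t‖ ≤ ‖(4 : K)‖) :
    y + t ∈ logUnits K := by
  have ht' : t ∈ logUnits K := closedBall_four_subset_logUnits (by rwa [mem_closedBall, dist_zero_right])
  exact (logUnitsAddSubgroup 2 K).add_mem hy ht'

/-- **`log₂(𝒪_K^×) = 2·℘(𝒪_K) + 4·𝒪_K`** for unramified `K/ℚ₂`: `y ∈ log₂(𝒪^×) ↔ ∃ x ∈ 𝒪, ‖y − 2(x + x²)‖ ≤ ‖4‖`.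
(`→`: for a unit `u` pick an odd `m` with `u^m = 1 − 2x` principal; `m·log₂ u ≡ −2(x + x²) ≡ 2(x + x²)` and
`m⁻¹ ≡ 1 (mod 2)`. `←`: `y = (y + log₂(1 − 2x)) − log₂(1 − 2x)` with the first summand in `4𝒪 ⊆ log₂(𝒪^×)`.)
[cite: NeukirchANT1999, Ch. II Prop. (5.5)] -/
theorem mem_logUnits_iff_exists_norm_sub_le (he : absRamificationIdx 2 K = 1) (y : K) :
    y ∈ logUnits K ↔ ∃ x : K, ‖x‖ ≤ 1 ∧ ‖y - 2 * (x + x ^ 2)‖ ≤ ‖(4 : K)‖ := by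
  constructor
  · rintro ⟨u, hu, rfl⟩
    rw [mem_setOf_eq] at hu
    obtain ⟨m, hm, hm2, hmP⟩ := exists_pow_isPrincipal_not_dvd (p := 2) hu
    -- `u^m = 1 − 2x` with `x ∈ 𝒪`
    have hd : ‖1 - u ^ m‖ ≤ 2⁻¹ := norm_le_half_of_norm_lt_one he hmP
    set x : K := (1 - u ^ m) / 2 with hxdef
    have hx : ‖x‖ ≤ 1 := by
      rw [hxdef, norm_div, WildDyadic.norm_two, div_le_iff₀ (by norm_num : (0 : ℝ) < 2⁻¹), one_mul]
      exact hd
    have hux : u ^ m = 1 - 2 * x := by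
      have h2 : (2 : K) ≠ 0 := norm_pos_iff.mp (by rw [WildDyadic.norm_two]; norm_num)
      rw [hxdef, mul_div_cancel₀ _ h2, sub_sub_cancel]
    refine ⟨x, hx, ?_⟩
    -- `m · log₂ u = log₂ (u^m) = −2(x + x²) + t`, `‖t‖ ≤ ‖4‖`
    have hmlog : (m : K) * unitLog u = unitLog (1 - 2 * x) := by rw [← hux, unitLog_pow 2 hu m]
    have hm1 : ‖(m : K)‖ = 1 := norm_natCast_eq_one_of_not_dvd 2 hm2
    have hm0 : (m : K) ≠ 0 := norm_pos_iff.mp (by rw [hm1]; exact one_pos)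
    have hxx : ‖x + x ^ 2‖ ≤ 1 := by
      refine (IsUltrametricDist.norm_add_le_max _ _).trans (max_le hx ?_)
      rw [norm_pow]; exact pow_le_one₀ (norm_nonneg x) hx
    -- decomposition of `log₂ u − 2(x + x²)`
    have hdec : unitLog u - 2 * (x + x ^ 2) =
        ((m : K))⁻¹ * (unitLog (1 - 2 * x) + 2 * (x + x ^ 2))
          + ((((m : K))⁻¹ - 1) * (-(2 * (x + x ^ 2))) + (-(4 * (x + x ^ 2)))) := by
      rw [← hmlog]
      field_simp
      ring
    rw [hdec]
    refine (IsUltrametricDist.norm_add_le_max _ _).trans (max_le ?_ ?_)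
    · rw [norm_mul, norm_inv, hm1, inv_one, one_mul]
      exact norm_unitLog_one_sub_two_mul_add_le hx
    · refine (IsUltrametricDist.norm_add_le_max _ _).trans (max_le ?_ ?_)
      · rw [norm_mul, norm_neg, norm_mul, WildDyadic.norm_two, norm_four]
        calc ‖((m : K))⁻¹ - 1‖ * (2⁻¹ * ‖x + x ^ 2‖) ≤ 2⁻¹ * (2⁻¹ * 1) := by
              gcongr
              exact norm_inv_natCast_sub_one_le hm2
          _ = 4⁻¹ := by norm_num
      · rw [norm_neg, norm_mul, norm_four]
        exact mul_le_of_le_one_right (by norm_num) hxx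
  · rintro ⟨x, hx, hyx⟩
    have hP := isPrincipal_one_sub_two_mul hx
    have h1 : unitLog (1 - 2 * x) ∈ logUnits K := unitLog_mem_logUnits hP.norm_eq_one
    have hneg : -unitLog (1 - 2 * x) ∈ logUnits K := (logUnitsAddSubgroup 2 K).neg_mem h1
    -- `y + log₂(1 − 2x) ∈ 4𝒪`
    have ht : ‖(y - 2 * (x + x ^ 2)) + (unitLog (1 - 2 * x) + 2 * (x + x ^ 2))‖ ≤ ‖(4 : K)‖ :=
      (IsUltrametricDist.norm_add_le_max _ _).trans (max_le hyx (norm_unitLog_one_sub_two_mul_add_le hx))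
    have hmem := add_mem_logUnits_of_norm_le hneg ht
    have hid : -unitLog (1 - 2 * x) + ((y - 2 * (x + x ^ 2)) + (unitLog (1 - 2 * x) + 2 * (x + x ^ 2))) = y := by
      ring
    rwa [hid] at hmem

/-- `2(x + x²) ∈ log₂(𝒪_K^×)` for every `x ∈ 𝒪_K` (unramified `K`). [cite: NeukirchANT1999, Ch. II Prop. (5.5)] -/
theorem two_mul_artinSchreier_mem_logUnits (he : absRamificationIdx 2 K = 1) {x : K} (hx : ‖x‖ ≤ 1) :
    2 * (x + x ^ 2) ∈ logUnits K :=
  (mem_logUnits_iff_exists_norm_sub_le he _).mpr ⟨x, hx, by rw [sub_self, norm_zero]; exact norm_nonneg _⟩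

/-! ## 4. Residue-field form: `log₂(𝒪^×)/4𝒪 = 2·℘(k)` inside `2𝒪/4𝒪 ≅ k` -/

section Residue

open scoped NormedField

omit instK [CompleteSpace K] in
/-- Two integers have the same residue iff their difference has norm `< 1` (inside this namespace the local-ring
structure of `𝒪` is found through abc-iut-S1's scoped `isDiscreteValuationRing_integer`, whence `[ProperSpace K]`).
[cite: NeukirchANT1999, Ch. II Prop. (3.8)] -/
theorem residue_eq_iff_norm_sub_lt_one (x y : Valued.integer K) :
    residue (Valued.integer K) x = residue (Valued.integer K) y ↔ ‖(x : K) - y‖ < 1 := by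
  rw [← sub_eq_zero, ← map_sub, residue_eq_zero_iff, mem_maximalIdeal_iff_norm_lt_one]
  rfl

/-- **Residue form of the Artin–Schreier description**: for `y ∈ 𝒪`, `2y ∈ log₂(𝒪^×) ↔ ȳ ∈ ℘(k)`,
`℘(b) = b² + b`. [cite: NeukirchANT1999, Ch. II Prop. (5.5)] -/
theorem two_mul_mem_logUnits_iff_residue (he : absRamificationIdx 2 K = 1) (y : Valued.integer K) :
    2 * (y : K) ∈ logUnits K ↔
      ∃ b : ResidueField (Valued.integer K), residue (Valued.integer K) y = b ^ 2 + b := by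
  rw [mem_logUnits_iff_exists_norm_sub_le he]
  constructor
  · rintro ⟨x, hx, hxy⟩
    refine ⟨residue _ ⟨x, Valued.integer.mem_iff.mpr hx⟩, ?_⟩
    rw [← map_pow, ← map_add, residue_eq_iff_norm_sub_lt_one]
    have h2 : ‖2 * ((y : K) - (x + x ^ 2))‖ ≤ ‖(4 : K)‖ := by rwa [mul_sub]
    rw [norm_mul, WildDyadic.norm_two, norm_four] at h2
    have h3 : ‖(y : K) - (x + x ^ 2)‖ ≤ 2⁻¹ := by linarith
    have h4 : ‖(y : K) - (x ^ 2 + x)‖ ≤ 2⁻¹ := by rwa [add_comm (x ^ 2)]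
    exact h4.trans_lt (by norm_num)
  · rintro ⟨b, hb⟩
    obtain ⟨x, rfl⟩ := residue_surjective b
    have hx : ‖(x : K)‖ ≤ 1 := Valued.integer.norm_le_one x
    refine ⟨(x : K), hx, ?_⟩
    have h1 : ‖(y : K) - ((x ^ 2 + x : Valued.integer K) : K)‖ < 1 := by
      rw [← residue_eq_iff_norm_sub_lt_one, map_add, map_pow]
      exact hb
    have h2 : ‖(y : K) - (x + x ^ 2)‖ < 1 := by
      push_cast at h1
      rwa [add_comm] at h1
    have h3 : ‖(y : K) - (x + x ^ 2)‖ ≤ 2⁻¹ := norm_le_half_of_norm_lt_one he h2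
    rw [← mul_sub, norm_mul, WildDyadic.norm_two, norm_four]
    linarith

/-! ## 5. `f = 1`: `log₂(𝒪^×) = 4𝒪`; `f ≥ 2`: `4𝒪 ⊊ log₂(𝒪^×) ⊊ 2𝒪`, not a fractional ideal -/

/-- **`f = 1` ⇒ `log₂(𝒪_K^×) = 4𝒪_K`** (`K` unramified with residue field `𝔽₂`, e.g. `ℚ₂`: `log₂(ℤ₂^×) = 4ℤ₂`):
every unit is `≡ 1 (mod 2)` and `x + x² ∈ 2𝒪` for all `x ∈ 𝒪` (abc-iut-w5-d172's `norm_add_sq_le`).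
[cite: NeukirchANT1999, Ch. II Prop. (5.5)] -/
theorem logUnits_eq_closedBall_four_of_residueDegree_eq_one (he : absRamificationIdx 2 K = 1)
    (hf : residueDegree 2 K = 1) : logUnits K = closedBall (0 : K) ‖(4 : K)‖ := by
  refine Subset.antisymm (fun y hy => ?_) closedBall_four_subset_logUnits
  obtain ⟨x, hx, hyx⟩ := (mem_logUnits_iff_exists_norm_sub_le he y).mp hy
  have hxx : ‖x + x ^ 2‖ ≤ 2⁻¹ :=
    WildDyadic.norm_add_sq_le le_rfl (fun z hz => norm_le_half_of_norm_lt_one he hz)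
      (fun u hu => WildDyadic.isPrincipal_of_residueDegree_eq_one hf hu) hx
  rw [mem_closedBall, dist_zero_right]
  have h2 : ‖2 * (x + x ^ 2)‖ ≤ ‖(4 : K)‖ := by
    rw [norm_mul, WildDyadic.norm_two, norm_four]
    linarith
  calc ‖y‖ = ‖(y - 2 * (x + x ^ 2)) + 2 * (x + x ^ 2)‖ := by rw [sub_add_cancel]
    _ ≤ max ‖y - 2 * (x + x ^ 2)‖ ‖2 * (x + x ^ 2)‖ := IsUltrametricDist.norm_add_le_max _ _
    _ ≤ ‖(4 : K)‖ := max_le hyx h2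

/-- **`f ≥ 2` ⇒ `log₂(𝒪_K^×) ≠ c·𝒪_K` for every `c`**: the log-shell `4⁻¹·log₂(𝒪^×)` of an unramified dyadic
field with residue field `≠ 𝔽₂` is NOT a fractional ideal. [cite: MochizukiAbsTopIII2015, Def. 5.4 (iii) p. 126] -/
theorem logUnits_ne_smul_closedBall (he : absRamificationIdx 2 K = 1) (hf : 2 ≤ residueDegree 2 K) (c : K) :
    logUnits K ≠ c • closedBall (0 : K) 1 := by
  rw [smul_unitClosedBall]
  exact logUnits_ne_closedBall he hf ‖c‖

/-- `f ≥ 2` ⇒ `4𝒪 ⊊ log₂(𝒪^×)`. [cite: NeukirchANT1999, Ch. II Prop. (5.5)] -/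
theorem closedBall_four_ssubset_logUnits (he : absRamificationIdx 2 K = 1) (hf : 2 ≤ residueDegree 2 K) :
    closedBall (0 : K) ‖(4 : K)‖ ⊂ logUnits K :=
  closedBall_four_subset_logUnits.ssubset_of_ne (logUnits_ne_closedBall he hf _).symm

/-- `log₂(𝒪^×) ⊊ 2𝒪` (every unramified `K`). [cite: NeukirchANT1999, Ch. II Prop. (5.5)] -/
theorem logUnits_ssubset_closedBall_two (he : absRamificationIdx 2 K = 1) :
    logUnits K ⊂ closedBall (0 : K) ‖(2 : K)‖ := by
  refine (logUnits_subset_closedBall_two he).ssubset_of_ne fun hL => ?_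
  obtain ⟨y, hyn, hy⟩ := exists_norm_le_half_not_mem_logUnits he
  exact hy (by rw [hL, mem_closedBall, dist_zero_right, WildDyadic.norm_two]; exact hyn)

end Residue

end UnramifiedDyadic

end Literature.IUT.LogVolume

end
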